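import Summits.CriticalPhenomena.PercolationContinuityZ3.Theorems.PercNearOneGluingNearOneGluingQ7ThreeCut
import Summits.CriticalPhenomena.PercolationContinuityZ3.Theorems.PercNearOneGluingNearOneGluingR3OfR3pp
import Summits.CriticalPhenomena.PercolationContinuityZ3.Theorems.PercNearOneGluingNearOneGluingR3ppOfS12

/-!
# Kozma–Nitzan Question 7 for three relays from the two exchange-slack inequalities S1, S2

Lead c6, crux `NearOneGluing` (KN Conjecture 3), line SketchR2I5.  This file composes the landed chain

  `Q7₃ ⟸ (R3)` (`q7Three_of_R3`) `⟸ (R3″)` (`r3_of_r3pp`) `⟸ S12` (`r3pp_of_s12`) `⟸ S1 ∧ S2` (this file),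

so that Kozma–Nitzan's Question 7 [cite: KozmaNitzan2024, Question 7 (p. 36)] and Conjecture 1
[cite: KozmaNitzan2024, Conjecture 1 (p. 3)] for three relays `x, y, z` with `z` the least reliable one
follow from the two registered stubs `stub_exchS1`, `stub_exchS2` (the conditional van den
Berg–Häggström–Kahn-type "exchange" inequalities; 0 violations in exhaustive enumeration, open).
Notation: `D := {y ↮ z}`, `D_a := {x ↮ y} ∩ {x ↮ z}`, `W := D_a ∩ {o ↔ x}`,
`σ₁(Q) := μ(D)μ(Q ∩ {y↔b} ∩ D) − μ(Q ∩ D)μ({y↔b} ∩ D)`,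
`σ₂(Q) := μ(Q ∩ D)μ({z↔b} ∩ D) − μ(D)μ(Q ∩ {z↔b} ∩ D)`;
S1: `μ(W)σ₁({x↔y}) ≤ μ(D_a)σ₁({o↔y})`, S2: `μ(W)σ₂({x↔y}) ≤ μ(D_a)σ₂({o↔y})`.
-/

namespace Summit.CriticalPhenomena.PercolationContinuityZ3.Theorems

open MeasureTheory Set Literature.Probability.LatticeModels Literature.Probability.Percolation
open scoped Classical
open Q7ThreeCut

section

variable {n : ℕ}

/-- On `{y ↔ z}` the events `{y ↔ b}` and `{z ↔ b}` coincide, hence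
`μ({y↔b} ∩ {y↮z}) − μ({z↔b} ∩ {y↮z}) = μ(y↔b) − μ(z↔b)`. [folklore] -/
theorem real_yb_inter_sub_zb_inter (w : Sym2 (Fin n) → unitInterval) (b y z : Fin n) :
    (prodBernoulli w).real (openConn y b ∩ (openConn y z)ᶜ) -
        (prodBernoulli w).real (openConn z b ∩ (openConn y z)ᶜ) =
      (prodBernoulli w).real (openConn y b) - (prodBernoulli w).real (openConn z b) := by
  set μ := prodBernoulli w with hμ
  have hy := R3OfR3pp.measureReal_split μ (openConn y b : Set (BondConfig (Fin n)))
    ((openConn y z)ᶜ : Set (BondConfig (Fin n)))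
  have hz := R3OfR3pp.measureReal_split μ (openConn z b : Set (BondConfig (Fin n)))
    ((openConn y z)ᶜ : Set (BondConfig (Fin n)))
  have hset : (openConn y b ∩ (openConn y z)ᶜᶜ : Set (BondConfig (Fin n))) =
      openConn z b ∩ (openConn y z)ᶜᶜ := by
    ext ω
    simp only [compl_compl, mem_inter_iff]
    constructor
    · rintro ⟨hyb, hyz⟩
      exact ⟨conn_trans (conn_symm hyz) hyb, hyz⟩
    · rintro ⟨hzb, hyz⟩
      exact ⟨conn_trans hyz hzb, hyz⟩
  rw [hset] at hy
  linarith

/-- **S1 ∧ S2 ⟹ S12** in the form consumed by `r3pp_of_s12` (the summed slack with the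
unconditional reliability gap `μ(y↔b) − μ(z↔b)`). [cite: KozmaNitzan2024, Question 7 (p. 36)] -/
theorem s12_of_s1_s2 (w : Sym2 (Fin n) → unitInterval) (o b x y z : Fin n)
    (hS1 : (prodBernoulli w).real (((openConn x y)ᶜ ∩ (openConn x z)ᶜ) ∩ openConn o x) *
        ((prodBernoulli w).real (openConn y z)ᶜ *
            (prodBernoulli w).real (openConn x y ∩ openConn y b ∩ (openConn y z)ᶜ) -
          (prodBernoulli w).real (openConn x y ∩ (openConn y z)ᶜ) *
            (prodBernoulli w).real (openConn y b ∩ (openConn y z)ᶜ)) ≤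
      (prodBernoulli w).real ((openConn x y)ᶜ ∩ (openConn x z)ᶜ) *
        ((prodBernoulli w).real (openConn y z)ᶜ *
            (prodBernoulli w).real (openConn o y ∩ openConn y b ∩ (openConn y z)ᶜ) -
          (prodBernoulli w).real (openConn o y ∩ (openConn y z)ᶜ) *
            (prodBernoulli w).real (openConn y b ∩ (openConn y z)ᶜ)))
    (hS2 : (prodBernoulli w).real (((openConn x y)ᶜ ∩ (openConn x z)ᶜ) ∩ openConn o x) *
        ((prodBernoulli w).real (openConn x y ∩ (openConn y z)ᶜ) *
            (prodBernoulli w).real (openConn z b ∩ (openConn y z)ᶜ) -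
          (prodBernoulli w).real (openConn y z)ᶜ *
            (prodBernoulli w).real (openConn x y ∩ openConn z b ∩ (openConn y z)ᶜ)) ≤
      (prodBernoulli w).real ((openConn x y)ᶜ ∩ (openConn x z)ᶜ) *
        ((prodBernoulli w).real (openConn o y ∩ (openConn y z)ᶜ) *
            (prodBernoulli w).real (openConn z b ∩ (openConn y z)ᶜ) -
          (prodBernoulli w).real (openConn y z)ᶜ *
            (prodBernoulli w).real (openConn o y ∩ openConn z b ∩ (openConn y z)ᶜ))) :
    (prodBernoulli w).real (((openConn x y)ᶜ ∩ (openConn x z)ᶜ) ∩ openConn o x) *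
        ((prodBernoulli w).real (openConn y z)ᶜ *
            ((prodBernoulli w).real (openConn x y ∩ openConn y b ∩ (openConn y z)ᶜ) -
              (prodBernoulli w).real (openConn x y ∩ openConn z b ∩ (openConn y z)ᶜ)) -
          (prodBernoulli w).real (openConn x y ∩ (openConn y z)ᶜ) *
            ((prodBernoulli w).real (openConn y b) - (prodBernoulli w).real (openConn z b))) ≤
      (prodBernoulli w).real ((openConn x y)ᶜ ∩ (openConn x z)ᶜ) *
        ((prodBernoulli w).real (openConn y z)ᶜ *
            ((prodBernoulli w).real (openConn o y ∩ openConn y b ∩ (openConn y z)ᶜ) -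
              (prodBernoulli w).real (openConn o y ∩ openConn z b ∩ (openConn y z)ᶜ)) -
          (prodBernoulli w).real (openConn o y ∩ (openConn y z)ᶜ) *
            ((prodBernoulli w).real (openConn y b) - (prodBernoulli w).real (openConn z b))) := by
  have hgap := real_yb_inter_sub_zb_inter w b y z
  rw [← hgap]
  nlinarith [hS1, hS2]

/-- **Kozma–Nitzan Question 7 for three relays from S1 ∧ S2.**  For relays `x, y, z` with `z` the
least reliable (`μ(z↔b) ≤ μ(y↔b)`, `μ(z↔b) ≤ μ(x↔b)`), the exchange-slack inequalities S1 and S2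
imply `μ(z↔b, o↔A) ≤ μ(o↔b, o↔A)`, `A = {x,y,z}` — the composition
`q7Three_of_R3 ∘ r3_of_r3pp ∘ r3pp_of_s12 ∘ s12_of_s1_s2`.
[cite: KozmaNitzan2024, Question 7 (p. 36)] -/
theorem q7Three_of_exch (w : Sym2 (Fin n) → unitInterval) (o b x y z : Fin n)
    (hxy : x ≠ y) (hxz : x ≠ z)
    (hzy : (prodBernoulli w).real (openConn z b) ≤ (prodBernoulli w).real (openConn y b))
    (hzx : (prodBernoulli w).real (openConn z b) ≤ (prodBernoulli w).real (openConn x b))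
    (hS1 : (prodBernoulli w).real (((openConn x y)ᶜ ∩ (openConn x z)ᶜ) ∩ openConn o x) *
        ((prodBernoulli w).real (openConn y z)ᶜ *
            (prodBernoulli w).real (openConn x y ∩ openConn y b ∩ (openConn y z)ᶜ) -
          (prodBernoulli w).real (openConn x y ∩ (openConn y z)ᶜ) *
            (prodBernoulli w).real (openConn y b ∩ (openConn y z)ᶜ)) ≤
      (prodBernoulli w).real ((openConn x y)ᶜ ∩ (openConn x z)ᶜ) *
        ((prodBernoulli w).real (openConn y z)ᶜ *
            (prodBernoulli w).real (openConn o y ∩ openConn y b ∩ (openConn y z)ᶜ) -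
          (prodBernoulli w).real (openConn o y ∩ (openConn y z)ᶜ) *
            (prodBernoulli w).real (openConn y b ∩ (openConn y z)ᶜ)))
    (hS2 : (prodBernoulli w).real (((openConn x y)ᶜ ∩ (openConn x z)ᶜ) ∩ openConn o x) *
        ((prodBernoulli w).real (openConn x y ∩ (openConn y z)ᶜ) *
            (prodBernoulli w).real (openConn z b ∩ (openConn y z)ᶜ) -
          (prodBernoulli w).real (openConn y z)ᶜ *
            (prodBernoulli w).real (openConn x y ∩ openConn z b ∩ (openConn y z)ᶜ)) ≤
      (prodBernoulli w).real ((openConn x y)ᶜ ∩ (openConn x z)ᶜ) *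
        ((prodBernoulli w).real (openConn o y ∩ (openConn y z)ᶜ) *
            (prodBernoulli w).real (openConn z b ∩ (openConn y z)ᶜ) -
          (prodBernoulli w).real (openConn y z)ᶜ *
            (prodBernoulli w).real (openConn o y ∩ openConn z b ∩ (openConn y z)ᶜ))) :
    (prodBernoulli w).real (openConn z b ∩ (openConn o x ∪ openConn o y ∪ openConn o z)) ≤
      (prodBernoulli w).real (openConn o b ∩ (openConn o x ∪ openConn o y ∪ openConn o z)) :=
  q7Three_of_R3 w o b x y z hxy hxz hzy
    (r3_of_r3pp w o b x y z hzx (r3pp_of_s12 w o b x y z hxz hzy (s12_of_s1_s2 w o b x y z hS1 hS2)))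

/-- **Kozma–Nitzan Conjecture 1 for three relays from S1 ∧ S2**: under the hypotheses of
`q7Three_of_exch`, `μ(o ↔ A)·μ(z ↔ b) ≤ μ(o ↔ b)` for the least reliable relay `z` (hence for the
minimiser over `A`), by Harris' inequality. [cite: KozmaNitzan2024, Conjecture 1 (p. 3)] -/
theorem conjOneThree_of_exch (w : Sym2 (Fin n) → unitInterval) (o b x y z : Fin n)
    (hxy : x ≠ y) (hxz : x ≠ z)
    (hzy : (prodBernoulli w).real (openConn z b) ≤ (prodBernoulli w).real (openConn y b))
    (hzx : (prodBernoulli w).real (openConn z b) ≤ (prodBernoulli w).real (openConn x b))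
    (hS1 : (prodBernoulli w).real (((openConn x y)ᶜ ∩ (openConn x z)ᶜ) ∩ openConn o x) *
        ((prodBernoulli w).real (openConn y z)ᶜ *
            (prodBernoulli w).real (openConn x y ∩ openConn y b ∩ (openConn y z)ᶜ) -
          (prodBernoulli w).real (openConn x y ∩ (openConn y z)ᶜ) *
            (prodBernoulli w).real (openConn y b ∩ (openConn y z)ᶜ)) ≤
      (prodBernoulli w).real ((openConn x y)ᶜ ∩ (openConn x z)ᶜ) *
        ((prodBernoulli w).real (openConn y z)ᶜ *
            (prodBernoulli w).real (openConn o y ∩ openConn y b ∩ (openConn y z)ᶜ) -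
          (prodBernoulli w).real (openConn o y ∩ (openConn y z)ᶜ) *
            (prodBernoulli w).real (openConn y b ∩ (openConn y z)ᶜ)))
    (hS2 : (prodBernoulli w).real (((openConn x y)ᶜ ∩ (openConn x z)ᶜ) ∩ openConn o x) *
        ((prodBernoulli w).real (openConn x y ∩ (openConn y z)ᶜ) *
            (prodBernoulli w).real (openConn z b ∩ (openConn y z)ᶜ) -
          (prodBernoulli w).real (openConn y z)ᶜ *
            (prodBernoulli w).real (openConn x y ∩ openConn z b ∩ (openConn y z)ᶜ)) ≤
      (prodBernoulli w).real ((openConn x y)ᶜ ∩ (openConn x z)ᶜ) *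
        ((prodBernoulli w).real (openConn o y ∩ (openConn y z)ᶜ) *
            (prodBernoulli w).real (openConn z b ∩ (openConn y z)ᶜ) -
          (prodBernoulli w).real (openConn y z)ᶜ *
            (prodBernoulli w).real (openConn o y ∩ openConn z b ∩ (openConn y z)ᶜ))) :
    (prodBernoulli w).real (openConn o x ∪ openConn o y ∪ openConn o z) *
        (prodBernoulli w).real (openConn z b) ≤
      (prodBernoulli w).real (openConn o b) := by
  have hq7 := q7Three_of_exch w o b x y z hxy hxz hzy hzx hS1 hS2
  have hup : IsUpperSet (openConn o x ∪ openConn o y ∪ openConn o z : Set (BondConfig (Fin n))) :=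
    ((isUpperSet_openConn o x).union (isUpperSet_openConn o y)).union (isUpperSet_openConn o z)
  have hhar := prodBernoulli_harris w (isUpperSet_openConn z b) hup MeasurableSet.of_discrete
    MeasurableSet.of_discrete
  have hmono : (prodBernoulli w).real (openConn o b ∩ (openConn o x ∪ openConn o y ∪ openConn o z)) ≤
      (prodBernoulli w).real (openConn o b) := measureReal_mono inter_subset_left
  nlinarith [hhar, hq7, hmono, mul_comm ((prodBernoulli w).real (openConn o x ∪ openConn o y ∪ openConn o z))
    ((prodBernoulli w).real (openConn z b))]

/-- **From the registered stubs to Question 7 (three relays)**: if `stub_exchS1` and `stub_exchS2`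
hold (as registered on the crux item), then KN Question 7 holds for every three-relay set whose
least reliable relay is `z`. [cite: KozmaNitzan2024, Question 7 (p. 36)] -/
theorem q7Three_of_exchStubs
    (hS1 : ∀ (n : ℕ) (w : Sym2 (Fin n) → unitInterval) (o b x y z : Fin n), x ≠ y → x ≠ z → y ≠ z → (Literature.Probability.LatticeModels.prodBernoulli w).real (((Literature.Probability.Percolation.openConn x y)ᶜ ∩ (Literature.Probability.Percolation.openConn x z)ᶜ) ∩ Literature.Probability.Percolation.openConn o x) * ((Literature.Probability.LatticeModels.prodBernoulli w).real (Literature.Probability.Percolation.openConn y z)ᶜ * (Literature.Probability.LatticeModels.prodBernoulli w).real (Literature.Probability.Percolation.openConn x y ∩ Literature.Probability.Percolation.openConn y b ∩ (Literature.Probability.Percolation.openConn y z)ᶜ) - (Literature.Probability.LatticeModels.prodBernoulli w).real (Literature.Probability.Percolation.openConn x y ∩ (Literature.Probability.Percolation.openConn y z)ᶜ) * (Literature.Probability.LatticeModels.prodBernoulli w).real (Literature.Probability.Percolation.openConn y b ∩ (Literature.Probability.Percolation.openConn y z)ᶜ)) ≤ (Literature.Probability.LatticeModels.prodBernoulli w).real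 ((Literature.Probability.Percolation.openConn x y)ᶜ ∩ (Literature.Probability.Percolation.openConn x z)ᶜ) * ((Literature.Probability.LatticeModels.prodBernoulli w).real (Literature.Probability.Percolation.openConn y z)ᶜ * (Literature.Probability.LatticeModels.prodBernoulli w).real (Literature.Probability.Percolation.openConn o y ∩ Literature.Probability.Percolation.openConn y b ∩ (Literature.Probability.Percolation.openConn y z)ᶜ) - (Literature.Probability.LatticeModels.prodBernoulli w).real (Literature.Probability.Percolation.openConn o y ∩ (Literature.Probability.Percolation.openConn y z)ᶜ) * (Literature.Probability.LatticeModels.prodBernoulli w).real (Literature.Probability.Percolation.openConn y b ∩ (Literature.Probability.Percolation.openConn y z)ᶜ)))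
    (hS2 : ∀ (n : ℕ) (w : Sym2 (Fin n) → unitInterval) (o b x y z : Fin n), x ≠ y → x ≠ z → y ≠ z → (Literature.Probability.LatticeModels.prodBernoulli w).real (((Literature.Probability.Percolation.openConn x y)ᶜ ∩ (Literature.Probability.Percolation.openConn x z)ᶜ) ∩ Literature.Probability.Percolation.openConn o x) * ((Literature.Probability.LatticeModels.prodBernoulli w).real (Literature.Probability.Percolation.openConn x y ∩ (Literature.Probability.Percolation.openConn y z)ᶜ) * (Literature.Probability.LatticeModels.prodBernoulli w).real (Literature.Probability.Percolation.openConn z b ∩ (Literature.Probability.Percolation.openConn y z)ᶜ) - (Literature.Probability.LatticeModels.prodBernoulli w).real (Literature.Probability.Percolation.openConn y z)ᶜ * (Literature.Probability.LatticeModels.prodBernoulli w).real (Literature.Probability.Percolation.openConn x y ∩ Literature.Probability.Percolation.openConn z b ∩ (Literature.Probability.Percolation.openConn y z)ᶜ)) ≤ (Literature.Probability.LatticeModels.prodBernoulli w).real ((Literature.Probability.Percolation.openConn x y)ᶜ ∩ (Literature.Probability.Percolation.openConn x z)ᶜ) * ((Literature.Probability.LatticeModels.prodBernoulli w).real (Literature.Probability.Percolation.openConn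 o y ∩ (Literature.Probability.Percolation.openConn y z)ᶜ) * (Literature.Probability.LatticeModels.prodBernoulli w).real (Literature.Probability.Percolation.openConn z b ∩ (Literature.Probability.Percolation.openConn y z)ᶜ) - (Literature.Probability.LatticeModels.prodBernoulli w).real (Literature.Probability.Percolation.openConn y z)ᶜ * (Literature.Probability.LatticeModels.prodBernoulli w).real (Literature.Probability.Percolation.openConn o y ∩ Literature.Probability.Percolation.openConn z b ∩ (Literature.Probability.Percolation.openConn y z)ᶜ)))
    (w : Sym2 (Fin n) → unitInterval) (o b x y z : Fin n) (hxy : x ≠ y) (hxz : x ≠ z) (hyz : y ≠ z)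
    (hzy : (prodBernoulli w).real (openConn z b) ≤ (prodBernoulli w).real (openConn y b))
    (hzx : (prodBernoulli w).real (openConn z b) ≤ (prodBernoulli w).real (openConn x b)) :
    (prodBernoulli w).real (openConn z b ∩ (openConn o x ∪ openConn o y ∪ openConn o z)) ≤
      (prodBernoulli w).real (openConn o b ∩ (openConn o x ∪ openConn o y ∪ openConn o z)) :=
  q7Three_of_exch w o b x y z hxy hxz hzy hzx (hS1 n w o b x y z hxy hxz hyz) (hS2 n w o b x y z hxy hxz hyz)

/-- Registered stub form of `real_yb_inter_sub_zb_inter` (the reliability-gap identity used to pass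
from S1 ∧ S2 to the S12 hypothesis of `r3pp_of_s12`). [folklore] -/
theorem stub_ybGap : ∀ (n : ℕ) (w : Sym2 (Fin n) → unitInterval) (b y z : Fin n), (Literature.Probability.LatticeModels.prodBernoulli w).real (Literature.Probability.Percolation.openConn y b ∩ (Literature.Probability.Percolation.openConn y z)ᶜ) - (Literature.Probability.LatticeModels.prodBernoulli w).real (Literature.Probability.Percolation.openConn z b ∩ (Literature.Probability.Percolation.openConn y z)ᶜ) = (Literature.Probability.LatticeModels.prodBernoulli w).real (Literature.Probability.Percolation.openConn y b) - (Literature.Probability.LatticeModels.prodBernoulli w).real (Literature.Probability.Percolation.openConn z b) :=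
  fun _ w b y z => real_yb_inter_sub_zb_inter w b y z

end

end Summit.CriticalPhenomena.PercolationContinuityZ3.Theorems
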